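import Summits.BirchSwinnertonDyer.BirchSwinnertonDyer.Theorems.KolyvaginDepthDoorKolyvaginDepthSupplyDoorOfDatumPrintTwist
import Summits.BirchSwinnertonDyer.BirchSwinnertonDyer.Theorems.KolyvaginDepthDoorDepthTableRowKitPrint
import HarnessLib

/-!
# Route `KolyvaginDepthDoor` — the rank-2 TWIST-SELMER ROW KIT ON (γ) + a Kodaira–Néron certificate
# (no McCallum leaf, no F1; crux `KolyvaginDepthSupply`, stmt-BirchSwinnertonDyer-21765)

Helper file (`--supports stmt-BirchSwinnertonDyer-21765 --as helper`); it closes nothing and BSD is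
not proved by it.

`…LeavesOfPrint` (this seat) fed g7's twist-Selmer kit from (γ) + F1. This kit drops F1 for curves on the
Kodaira–Néron cell: `depthRow_twistSelmer_printKN_of_datum_of_intModel_certificate` — inputs = g7's
integer-model certificate of a rank-2 row, (γ) = `GrossLMS1991.prop37_2_frobeniusCongruence`, the
`decide`-able (KN_p) table of `Δ(E₀)`, ONE datum of conductor `ℓ` and its bit; output
`#Sel^(p)(E^{(D)}/ℚ) ≤ p` and the descent count `≤ p`. CONDITIONAL on (γ) and the bit; per-curve; BSD
is not proved by it.

References: [Kolyvagin1991MathAnn] Thm. 2.3; [GrossLMS1991] Prop. 3.7 (2), §5 (5.1);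
[McCallumLMS1991] §§2–5; [SilvermanAEC2009] VII.6.1; [WZhang2014] Notations (xii).
-/

set_option linter.dupNamespace false

noncomputable section

open scoped Classical NumberField

namespace Summit.BirchSwinnertonDyer.BirchSwinnertonDyer.Theorems.KolyvaginDepthDoor

open Literature.NumberTheory.EllipticCurves Literature.NumberTheory.EllipticCurves.ModularForms
  Literature.NumberTheory.EllipticCurves.McCallum1991 WeierstrassCurve NumberField IsDedekindDomain
open Literature.NumberTheory.DiophantineGeometry (KodairaSymbol)

section Generic

variable {W : WeierstrassCurve ℚ} [W.IsElliptic] [W.IsGloballyMinimal] {E₀ : WeierstrassCurve ℤ}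
  (hI : integralModelInt W = E₀)
include hI

/-- **The rank-2 TWIST-SELMER row kit on (γ) + a Kodaira–Néron certificate** (no McCallum leaf,
no F1): g7's `depthRow_noTwist_twistSelmer_of_datum_of_intModel_certificate` re-run over the twist
door `natCard_selmerGroup_twist_le_of_kolyvaginClass_ne_zero_of_datum_kodairaNeron`
(`…DoorOfDatumPrintTwist`), (KN_p) CERTIFIED from `Δ(E₀)` by `not_dvd_ordMinimalDiscriminant_of_intModel_table`:
from the bit at ANY datum of conductor `ℓ`, `#Sel^(p)(E^{(D)}/ℚ) ≤ p` and
`p^{rank E^{(D)}} · #E^{(D)}(ℚ)[p] · #Ш(E^{(D)}/ℚ)[p] ≤ p`. CONDITIONAL on (γ); per-curve; BSD is not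
proved by it. [cite: Kolyvagin1991MathAnn, Thm. 2.3] [cite: GrossLMS1991, Prop. 3.7 (2), §5 (5.1)]
[cite: SilvermanAEC2009, VII.6.1] -/
theorem depthRow_twistSelmer_printKN_of_datum_of_intModel_certificate
    (h372 : GrossLMS1991.prop37_2_frobeniusCongruence)
    (hcm : ¬ W.HasCM) (hr : 2 ≤ W.mordellWeilRank)
    (p : ℕ) [hp : Fact p.Prime] (hp2 : p ≠ 2)
    (htower : ∀ n : ℕ, W.HasSurjectiveModNGaloisRep (p ^ n : ℕ))
    (K : Type) [Field K] [NumberField K] (hK : IsImaginaryQuadratic K) {D : ℤ}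
    (hD : NumberField.discr K = D) (h3 : D ≠ -3) (h4 : D ≠ -4)
    (hH : ∀ q : ℕ, q.Prime → (q : ℤ) ∣ E₀.Δ → (q = 2 → D % 8 = 1) ∧ (q ≠ 2 → jacobiSym D q = 1))
    (ℓ : ℕ) (hℓ : ℓ.Prime) (hℓ2 : ℓ ≠ 2) (hℓΔ : ¬ (ℓ : ℤ) ∣ E₀.Δ) (hℓD : ¬ (ℓ : ℤ) ∣ D)
    (hℓp : ℓ ≠ p) (hjac : jacobiSym D ℓ = -1) (hℓ1 : p ∣ ℓ + 1) {n : ℕ}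
    (hcard : Nat.card ((E₀.map (Int.castRingHom (ZMod ℓ))).toAffine.Point) = n)
    (haℓ : (p : ℤ) ∣ (ℓ : ℤ) + 1 - n)
    {Δ₀ : ℤ} (hΔ : E₀.Δ = Δ₀) {B : ℕ} (hB : Δ₀.natAbs < B ^ p)
    (htab : ∀ q ∈ Finset.range B, q.Prime → q ∣ Δ₀.natAbs →
      ∃ e ∈ Finset.range 64, q ^ e ∣ Δ₀.natAbs ∧ ¬ q ^ (e + 1) ∣ Δ₀.natAbs ∧ ¬ p ∣ e)
    (hadd : ∀ v : HeightOneSpectrum (𝓞 ℚ), W.HasAdditiveReductionAt v → p ≠ 3 ∨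
      (W.kodairaSymbolAt v ≠ KodairaSymbol.IV ∧ W.kodairaSymbolAt v ≠ KodairaSymbol.IVstar))
    [NeZero (W.conductorNorm ℤ)] (Dt : ModularParametrizationData W (W.conductorNorm ℤ)) (β : ℤ)
    (ι : K →+* ℂ) (d : KolyvaginHeegnerData Dt β ι ℓ) (hne : d.kolyvaginClass hp.out 1 ≠ 0) :
    Nat.card ↥(selmerGroup (W.quadraticTwist (D : ℚ)) (p : ℤ)) ≤ p ∧
      p ^ (W.quadraticTwist (D : ℚ)).mordellWeilRank *
          Nat.card ↥(AddSubgroup.torsionBy (W.quadraticTwist (D : ℚ)).toAffine.Point (p : ℤ)) *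
          Nat.card ↥((W.quadraticTwist (D : ℚ)).sha ⊓
            AddSubgroup.torsionBy (W.quadraticTwist (D : ℚ)).galH1 (p : ℤ)) ≤ p := by
  obtain ⟨hkol, -⟩ := isKolyvaginPrime_of_intModel_certificate hI p K hK.1 hD ℓ hℓ hℓ2 hℓΔ hℓD
    hℓp hjac hℓ1 hcard haℓ
  obtain ⟨c, hc, hcc⟩ := exists_conj_of_isImaginaryQuadratic K hK
  have hH' := satisfiesHeegnerHypothesis_conductorNorm_of_intModel hI K hK.1 hD hH
  have hcard1 : ℓ.primeFactors.card = 1 := by rw [hℓ.primeFactors, Finset.card_singleton]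
  have hmult : ∀ v : HeightOneSpectrum (𝓞 ℚ), W.HasMultiplicativeReductionAt v →
      ¬ p ∣ W.ordMinimalDiscriminant v :=
    not_dvd_ordMinimalDiscriminant_of_intModel_table hI hΔ hB htab
  obtain ⟨-, hSel, hcount⟩ :=
    natCard_selmerGroup_twist_le_of_kolyvaginClass_ne_zero_of_datum_kodairaNeron h372 hcm hK
      (by rw [hD]; exact h3) (by rw [hD]; exact h4) hH' p hp2 htower c hc hcc hmult hadd
      hℓ.prime.squarefree
      (fun q hq ↦ by
        rw [hℓ.primeFactors, Finset.mem_singleton] at hq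
        exact hq ▸ hkol) d hne (by rw [hcard1]; exact hr)
  rw [hcard1, pow_one] at hSel hcount
  rw [hD] at hSel hcount
  exact ⟨hSel, hcount⟩

end Generic

end Summit.BirchSwinnertonDyer.BirchSwinnertonDyer.Theorems.KolyvaginDepthDoor

end
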